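import Mathlib
import Literature.NumberTheory.LFunctions.FeketePolynomial
import Literature.RingTheory.Valuation.AlgClosedResidue
import Literature.RingTheory.Valuation.RootReduction
import Summits.ValiantsHypothesis.ValiantsHypothesis.Theses.FeketeSOS
import Summits.ValiantsHypothesis.ValiantsHypothesis.Theorems.FeketeSOSDepthZeroShadow
import Summits.ValiantsHypothesis.ValiantsHypothesis.Theorems.FeketeSOSSublinearShadowGaussPairModel

/-!
# `FeketeSOS.SublinearShadow` (stmt-ValiantsHypothesis-14990), line `Sketch`, reshape 4 — stub `stub_twoDeepShadow`

**Two deep terms are as good as none.**  Let `Σ_{k<s} c_k g_k² = F_p` over `ℂ` (`p` odd) and let `O ⊂ ℂ` be a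
valuation subring with `p ∈ 𝔪_O` such that every TERM `c_k g_k²` with `k ∉ {i, j}` has all its coefficients in `O`.
Then the two remaining terms merge into a product: `c_i g_i² + c_j g_j² = A·B` with `A, B = a g_i ± b g_j`
(`a² = c_i`, `b² = −c_j`), supported on `supp g_i ∪ supp g_j`, and `A·B = F_p − Σ_{k ∉ {i,j}} c_k g_k²` is
coefficientwise in `O`.  Gauss's lemma (`stub_gaussPairModel`) rewrites `A·B = A'·B'` with `A', B'` in `O[X]` on the
same supports, and `A'B' = ¼(A'+B')² − ¼(A'−B')²` (`¼ ∈ O` because `p` is odd) turns the representation into one with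
the SAME number of squares, total support `≤ 2S`, and every term `O`-integral — to which the landed
`depthZeroShadow_proof` applies: a cyclic characteristic-`p` shadow with `s` squares of degree `< p` and support `≤ 2S`.
-/

namespace Summit.ValiantsHypothesis.ValiantsHypothesis.Theorems.SublinearShadowSketch

open Polynomial Finset IsLocalRing
open scoped BigOperators
open Literature.NumberTheory.LFunctions
open Literature.RingTheory.Valuation

-- `Summit.ValiantsHypothesis.ValiantsHypothesis.…` is the tree's mandated single-conjunct layout (Sub = Summit).
set_option linter.dupNamespace false

/-- `2` is invertible in a valuation subring `O ⊂ ℂ` whose maximal ideal contains an odd prime `p`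
(`2u + pv = 1` in `ℤ`, and `𝔪_O` is a proper ideal). -/
theorem tds_inv_two_mem (O : ValuationSubring ℂ) {p : ℕ} (hp : p.Prime) (hp2 : p ≠ 2)
    (hpO : ((p : ℕ) : O) ∈ maximalIdeal O) : (2 : ℂ)⁻¹ ∈ O := by
  have hcop : Nat.Coprime 2 p := by
    rw [Nat.coprime_primes Nat.prime_two hp]
    exact fun h => hp2 h.symm
  have hZ : IsCoprime ((2 : ℕ) : ℤ) (p : ℤ) := Nat.isCoprime_iff_coprime.mpr hcop
  obtain ⟨u, v, huv⟩ := hZ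
  have hO : (u : O) * 2 + (v : O) * (p : O) = 1 := by
    have h := congrArg (Int.cast : ℤ → O) huv
    push_cast at h
    exact h
  have hunit : IsUnit (2 : O) := by
    by_contra hnu
    have h2 : (2 : O) ∈ maximalIdeal O := (mem_maximalIdeal _).mpr (mem_nonunits_iff.mpr hnu)
    have h1 : (1 : O) ∈ maximalIdeal O := by
      rw [← hO]
      exact Ideal.add_mem _ (Ideal.mul_mem_left _ _ h2) (Ideal.mul_mem_left _ _ hpO)
    exact (maximalIdeal.isMaximal O).ne_top ((Ideal.eq_top_iff_one _).mpr h1)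
  obtain ⟨w, hw⟩ := hunit.exists_right_inv
  have hwC : ((w : O) : ℂ) = (2 : ℂ)⁻¹ := by
    have h := congrArg (fun x : O => (x : ℂ)) hw
    push_cast at h
    exact eq_inv_of_mul_eq_one_right h
  rw [← hwC]
  exact w.2

/-- The support of a difference lies in the union of the supports. -/
theorem tds_support_sub {R : Type*} [Ring R] (f g : R[X]) : (f - g).support ⊆ f.support ∪ g.support := by
  rw [sub_eq_add_neg]
  exact support_add.trans (by rw [support_neg])

/-- **Two weighted squares are a product** on the union of the supports:
`c₁ g₁² + c₂ g₂² = (a g₁ + b g₂)(a g₁ − b g₂)` with `a² = c₁`, `b² = −c₂`. [folklore] -/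
theorem tds_split (c₁ c₂ : ℂ) (g₁ g₂ : ℂ[X]) :
    ∃ A B : ℂ[X], A * B = C c₁ * g₁ ^ 2 + C c₂ * g₂ ^ 2 ∧
      A.support ⊆ g₁.support ∪ g₂.support ∧ B.support ⊆ g₁.support ∪ g₂.support := by
  obtain ⟨a, ha⟩ := IsAlgClosed.exists_pow_nat_eq c₁ (n := 2) two_pos
  obtain ⟨b, hb⟩ := IsAlgClosed.exists_pow_nat_eq (-c₂) (n := 2) two_pos
  refine ⟨C a * g₁ + C b * g₂, C a * g₁ - C b * g₂, ?_, ?_, ?_⟩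
  · have e : (C a * g₁ + C b * g₂) * (C a * g₁ - C b * g₂) = C (a ^ 2) * g₁ ^ 2 - C (b ^ 2) * g₂ ^ 2 := by
      simp only [C_pow]; ring
    rw [e, ha, hb, C_neg]; ring
  · refine (support_add).trans (Finset.union_subset_union ?_ ?_) <;> exact dzs_support_C_mul_subset _ _
  · refine (tds_support_sub _ _).trans (Finset.union_subset_union ?_ ?_) <;> exact dzs_support_C_mul_subset _ _

/-- Splitting a sum over `Fin s` at two distinct indices. -/
theorem tds_sum_split {M : Type*} [AddCommMonoid M] {s : ℕ} (f : Fin s → M) {i j : Fin s} (hij : i ≠ j) :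
    (∑ k, f k) = f i + f j + ∑ k ∈ (univ.erase i).erase j, f k := by
  classical
  have hj : j ∈ univ.erase i := Finset.mem_erase.mpr ⟨hij.symm, Finset.mem_univ j⟩
  rw [← Finset.add_sum_erase _ _ (Finset.mem_univ i), ← Finset.add_sum_erase _ _ hj, add_assoc]

/-- **`stub_twoDeepShadow` (registered stub of line `Sketch`, reshape 4).**  If `Σ_{k<s} c_k g_k² = F_p` over `ℂ`,
`p` odd, and at some valuation subring `O ⊂ ℂ` with `p ∈ 𝔪_O` every term `c_k g_k²` with `k ≠ i, j` has all its
coefficients in `O`, then `F̄_p` has a cyclic characteristic-`p` shadow with `s` weighted squares of degree `< p` and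
total support `≤ 2S`. -/
theorem stub_twoDeepShadow (p : ℕ) [Fact p.Prime] (hp2 : p ≠ 2) (s : ℕ) (c : Fin s → ℂ) (g : Fin s → ℂ[X])
    (hrep : (∑ i, C (c i) * g i ^ 2) = ∑ m ∈ Finset.range p, C ((legendreSym p m : ℤ) : ℂ) * X ^ m)
    (O : ValuationSubring ℂ) (hpO : ((p : ℕ) : O) ∈ maximalIdeal O) (i j : Fin s) (hij : i ≠ j)
    (hint : ∀ k, k ≠ i → k ≠ j → ∀ n, (C (c k) * g k ^ 2).coeff n ∈ O) :
    ∃ (K : Type) (_ : Field K) (_ : CharP K p) (c' : Fin s → K) (g' : Fin s → Polynomial K),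
      (∀ j, (g' j).natDegree < p) ∧
      (∑ j, (g' j).support.card) ≤ 2 * ∑ i, (g i).support.card ∧
      ((X : Polynomial K) ^ p - 1 ∣ (∑ j, C (c' j) * g' j ^ 2)
        - ∑ m ∈ Finset.range p, C ((legendreSym p m : ℤ) : K) * X ^ m) := by
  classical
  have hprime : p.Prime := Fact.out
  -- the terms and the target
  set T : Fin s → ℂ[X] := fun k => C (c k) * g k ^ 2 with hT
  set F : ℂ[X] := ∑ m ∈ Finset.range p, C ((legendreSym p m : ℤ) : ℂ) * X ^ m with hF
  have hFcoef : ∀ n, F.coeff n ∈ O := fun n => by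
    rw [hF, ← map_feketePolynomial_complex, coeff_map]
    exact intCast_mem O _
  -- membership in the complement of `{i, j}`
  have hmemR : ∀ k, k ∈ (univ.erase i).erase j ↔ k ≠ i ∧ k ≠ j := fun k => by
    simp only [Finset.mem_erase, Finset.mem_univ, and_true]
    tauto
  -- (1) the pair `T i + T j = F - Σ_{k ∉ {i,j}} T k` is `O`-integral
  have hsumT : (∑ k, T k) = T i + T j + ∑ k ∈ (univ.erase i).erase j, T k := tds_sum_split T hij
  have hpairEq : T i + T j = F - ∑ k ∈ (univ.erase i).erase j, T k := by
    rw [← hrep]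
    change T i + T j = (∑ k, T k) - _
    rw [hsumT]; ring
  have hrest : ∀ n, (∑ k ∈ (univ.erase i).erase j, T k).coeff n ∈ O := fun n => by
    rw [finsetSum_coeff]
    refine sum_mem fun k hk => ?_
    obtain ⟨hki, hkj⟩ := (hmemR k).mp hk
    exact hint k hki hkj n
  have hpair : ∀ n, (T i + T j).coeff n ∈ O := fun n => by
    rw [hpairEq, coeff_sub]
    exact sub_mem (hFcoef n) (hrest n)
  -- (2) split the pair into a product and (3) make both factors integral (Gauss)
  obtain ⟨A, B, hAB, hAsupp, hBsupp⟩ := tds_split (c i) (c j) (g i) (g j)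
  have hABint : ∀ n, (A * B).coeff n ∈ O := fun n => by rw [hAB]; exact hpair n
  obtain ⟨A', B', hA'B', hA'int, hB'int, hA'supp, hB'supp⟩ := stub_gaussPairModel O A B hABint
  -- lifts to `O[X]` and the constant `¼ ∈ O`
  obtain ⟨HA, hHA, hHAsupp⟩ := dzs_exists_lift O hA'int
  obtain ⟨HB, hHB, hHBsupp⟩ := dzs_exists_lift O hB'int
  have h2inv : (2 : ℂ)⁻¹ ∈ O := tds_inv_two_mem O hprime hp2 hpO
  have h4inv : (4 : ℂ)⁻¹ ∈ O := by
    have e : (4 : ℂ)⁻¹ = (2 : ℂ)⁻¹ * (2 : ℂ)⁻¹ := by norm_num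
    rw [e]; exact mul_mem h2inv h2inv
  set u : O := ⟨(4 : ℂ)⁻¹, h4inv⟩ with hu
  -- (4) the new representation: terms `i, j` replaced by `¼(A'+B')²` and `−¼(A'−B')²`
  set c₂ : Fin s → ℂ := Function.update (Function.update c i (4 : ℂ)⁻¹) j (-(4 : ℂ)⁻¹) with hc₂
  set g₂ : Fin s → ℂ[X] := Function.update (Function.update g i (A' + B')) j (A' - B') with hg₂
  have hc₂i : c₂ i = (4 : ℂ)⁻¹ := by
    rw [hc₂, Function.update_of_ne hij, Function.update_self]
  have hc₂j : c₂ j = -(4 : ℂ)⁻¹ := by rw [hc₂, Function.update_self]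
  have hc₂k : ∀ k, k ≠ i → k ≠ j → c₂ k = c k := fun k hki hkj => by
    rw [hc₂, Function.update_of_ne hkj, Function.update_of_ne hki]
  have hg₂i : g₂ i = A' + B' := by
    rw [hg₂, Function.update_of_ne hij, Function.update_self]
  have hg₂j : g₂ j = A' - B' := by rw [hg₂, Function.update_self]
  have hg₂k : ∀ k, k ≠ i → k ≠ j → g₂ k = g k := fun k hki hkj => by
    rw [hg₂, Function.update_of_ne hkj, Function.update_of_ne hki]
  set T₂ : Fin s → ℂ[X] := fun k => C (c₂ k) * g₂ k ^ 2 with hT₂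
  have hT₂k : ∀ k, k ≠ i → k ≠ j → T₂ k = T k := fun k hki hkj => by
    simp only [hT₂, hT, hc₂k k hki hkj, hg₂k k hki hkj]
  have hT₂ij : T₂ i + T₂ j = A' * B' := by
    simp only [hT₂, hc₂i, hc₂j, hg₂i, hg₂j, C_neg]
    have key : C (4 : ℂ)⁻¹ * (A' + B') ^ 2 + -C (4 : ℂ)⁻¹ * (A' - B') ^ 2
        = C (4 : ℂ)⁻¹ * C (4 : ℂ) * (A' * B') := by
      rw [map_ofNat C 4]; ring
    rw [key, ← C_mul, inv_mul_cancel₀ (by norm_num : (4 : ℂ) ≠ 0), C_1, one_mul]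
  -- the new family represents `F`
  have hrep₂ : (∑ k, C (c₂ k) * g₂ k ^ 2) = ∑ m ∈ Finset.range p, C ((legendreSym p m : ℤ) : ℂ) * X ^ m := by
    change (∑ k, T₂ k) = F
    rw [tds_sum_split T₂ hij, hT₂ij, hA'B', hAB]
    have hrestEq : (∑ k ∈ (univ.erase i).erase j, T₂ k) = ∑ k ∈ (univ.erase i).erase j, T k :=
      Finset.sum_congr rfl fun k hk => by
        obtain ⟨hki, hkj⟩ := (hmemR k).mp hk
        exact hT₂k k hki hkj
    rw [hrestEq]
    change T i + T j + _ = F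
    rw [hpairEq]; ring
  -- every new term is `O`-integral
  have huC : algebraMap O ℂ u = (4 : ℂ)⁻¹ := by rw [ValuationSubring.algebraMap_apply]
  have hmapi : (C u * (HA + HB) ^ 2).map (algebraMap O ℂ) = T₂ i := by
    rw [Polynomial.map_mul, Polynomial.map_pow, Polynomial.map_add, map_C, hHA, hHB, huC]
    simp only [hT₂, hc₂i, hg₂i]
  have hmapj : (C (-u) * (HA - HB) ^ 2).map (algebraMap O ℂ) = T₂ j := by
    rw [Polynomial.map_mul, Polynomial.map_pow, Polynomial.map_sub, map_C, hHA, hHB, map_neg, huC]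
    simp only [hT₂, hc₂j, hg₂j]
  have hcoef₂ : ∀ k n, (C (c₂ k) * g₂ k ^ 2).coeff n ∈ O := by
    intro k n
    by_cases hki : k = i
    · rw [hki]
      change (T₂ i).coeff n ∈ O
      rw [← hmapi, coeff_map, ValuationSubring.algebraMap_apply]
      exact SetLike.coe_mem _
    by_cases hkj : k = j
    · rw [hkj]
      change (T₂ j).coeff n ∈ O
      rw [← hmapj, coeff_map, ValuationSubring.algebraMap_apply]
      exact SetLike.coe_mem _
    · change (T₂ k).coeff n ∈ O
      rw [hT₂k k hki hkj]
      exact hint k hki hkj n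
  -- (5) depth zero: reduce and fold
  obtain ⟨K, instF, instC, c', g', hdeg', hsupp', hdvd'⟩ :=
    depthZeroShadow_proof p s c₂ g₂ hrep₂ ⟨O, hpO, hcoef₂⟩
  refine ⟨K, instF, instC, c', g', hdeg', ?_, hdvd'⟩
  -- (6) support bookkeeping: `Σ|supp g'_k| ≤ Σ|supp g₂ k| ≤ 2S`
  have hUi : (g₂ i).support.card ≤ (g i).support.card + (g j).support.card := by
    rw [hg₂i]
    calc (A' + B').support.card ≤ (A'.support ∪ B'.support).card := Finset.card_le_card support_add
      _ ≤ ((g i).support ∪ (g j).support).card :=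
          Finset.card_le_card (Finset.union_subset (hA'supp.trans hAsupp) (hB'supp.trans hBsupp))
      _ ≤ (g i).support.card + (g j).support.card := Finset.card_union_le _ _
  have hUj : (g₂ j).support.card ≤ (g i).support.card + (g j).support.card := by
    rw [hg₂j]
    calc (A' - B').support.card ≤ (A'.support ∪ B'.support).card := Finset.card_le_card (tds_support_sub _ _)
      _ ≤ ((g i).support ∪ (g j).support).card :=
          Finset.card_le_card (Finset.union_subset (hA'supp.trans hAsupp) (hB'supp.trans hBsupp))
      _ ≤ (g i).support.card + (g j).support.card := Finset.card_union_le _ _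
  have hrestS : (∑ k ∈ (univ.erase i).erase j, (g₂ k).support.card)
      = ∑ k ∈ (univ.erase i).erase j, (g k).support.card :=
    Finset.sum_congr rfl fun k hk => by
      obtain ⟨hki, hkj⟩ := (hmemR k).mp hk
      rw [hg₂k k hki hkj]
  calc (∑ k, (g' k).support.card) ≤ ∑ k, (g₂ k).support.card := Finset.sum_le_sum fun k _ => hsupp' k
    _ = (g₂ i).support.card + (g₂ j).support.card + ∑ k ∈ (univ.erase i).erase j, (g k).support.card := by
        rw [tds_sum_split (fun k => (g₂ k).support.card) hij, hrestS]
    _ ≤ 2 * ((g i).support.card + (g j).support.card + ∑ k ∈ (univ.erase i).erase j, (g k).support.card) := by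
        nlinarith [hUi, hUj, Nat.zero_le (∑ k ∈ (univ.erase i).erase j, (g k).support.card)]
    _ = 2 * ∑ k, (g k).support.card := by
        rw [tds_sum_split (fun k => (g k).support.card) hij]

end Summit.ValiantsHypothesis.ValiantsHypothesis.Theorems.SublinearShadowSketch
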